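import Summits.Ventures.Crystal3D.Theorems.StickyWulffConstantPolycrystalWulffBoundArrangementRefinement

/-!
# `PolycrystalWulffBound`: disjoint refinement of SEVERAL polyhedral grains over a common arrangement

Route `StickyWulffConstant` of the venture `Summits/Ventures/Crystal3D`, crux `PolycrystalWulffBound`
(item `stmt-Ventures-19482`), second prover lane; strengthens `exists_disjoint_polytope_refinement`
(`…ArrangementRefinement.lean`) for use on a whole TEXTURE: all grains' constraints are put into
ONE arrangement `𝓗`, and the returned disjoint cells `Q_j` (clause (B)'s format: bounded, unit
normals, distinct facet planes, pairwise disjoint, common planes `{⟪ν j j', x⟫ = b}`) additionally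
satisfy

* the DICHOTOMY against every sub-Finset `G ⊆ 𝓗` of constraints: `Q_j ⊆ polytope G` or
  `Disjoint Q_j (polytope G)` — so each cell belongs to a definite set of grains/pieces;
* the a.e. decomposition of EVERY sub-family `𝒢' ⊆ 𝒢` (e.g. the pieces of one grain):
  `⋃_{G ∈ 𝒢'} polytope G =ᵐ ⋃ {Q_j : Q_j ⊆ polytope G for some G ∈ 𝒢'}`.

With `PolytopeCalculus` (B) (19483) this turns, for a texture with polyhedral grains, every
`Per_K(G_f)`, `Per_K(G_f ∪ G_g)` and hence every interface term `ι_K(G_f, G_g)` of the crux into a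
facet sum over one family of disjoint cells (null sets do not change `Per_K`:
`anisotropicPerimeter_congr_ae`).
WHAT THIS IS NOT: the facet calculus; nothing on the crux beyond bookkeeping.
-/

noncomputable section

namespace Summit.Ventures.Crystal3D.Theorems

open MeasureTheory Set
open scoped RealInnerProductSpace Classical

variable {E : Type*} [NormedAddCommGroup E] [InnerProductSpace ℝ E] [FiniteDimensional ℝ E]
  [MeasurableSpace E] [BorelSpace E]

/-- **Disjoint refinement over a common arrangement, multi-family form.** As
`exists_disjoint_polytope_refinement` (same construction: the nonempty good cells of the arrangement of
`𝓗`), with two more conclusions: the dichotomy of every cell against every `polytope G`, `G ⊆ 𝓗`,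
and the a.e. decomposition of the polyhedral set of every sub-family `𝒢' ⊆ 𝒢` into the cells it
contains. -/
theorem exists_disjoint_polytope_refinement_multi (𝓗 : Finset (E × ℝ)) (h1 : ∀ p ∈ 𝓗, ‖p.1‖ = 1)
    (𝒢 : Finset (Finset (E × ℝ))) (h𝒢 : ∀ G ∈ 𝒢, G ⊆ 𝓗)
    (hb : ∀ G ∈ 𝒢, Bornology.IsBounded (⋂ p ∈ G, {x : E | ⟪p.1, x⟫ < p.2})) :
    ∃ (k : ℕ) (H : Fin k → Finset (E × ℝ)) (ν : Fin k → Fin k → E),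
      (∀ j, Bornology.IsBounded (⋂ q ∈ H j, {x : E | ⟪q.1, x⟫ < q.2})) ∧
      (∀ j, ∀ q ∈ H j, ‖q.1‖ = 1) ∧
      (∀ j, ∀ q ∈ H j, ∀ q' ∈ H j, q ≠ q' →
        {x : E | ⟪q.1, x⟫ = q.2} ≠ {x : E | ⟪q'.1, x⟫ = q'.2}) ∧
      (∀ j j', j ≠ j' → Disjoint (⋂ q ∈ H j, {x : E | ⟪q.1, x⟫ < q.2})
        (⋂ q ∈ H j', {x : E | ⟪q.1, x⟫ < q.2})) ∧
      (∀ j j', j ≠ j' → ‖ν j j'‖ = 1 ∧ ∃ b : ℝ,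
        closure (⋂ q ∈ H j, {x : E | ⟪q.1, x⟫ < q.2}) ∩
          closure (⋂ q ∈ H j', {x : E | ⟪q.1, x⟫ < q.2}) ⊆ {x : E | ⟪ν j j', x⟫ = b}) ∧
      (∀ j, (⋂ q ∈ H j, {x : E | ⟪q.1, x⟫ < q.2}) ⊆ ⋃ G ∈ 𝒢, ⋂ p ∈ G, {x : E | ⟪p.1, x⟫ < p.2}) ∧
      ((⋃ G ∈ 𝒢, ⋂ p ∈ G, {x : E | ⟪p.1, x⟫ < p.2}) =ᵐ[volume]
        ⋃ j, ⋂ q ∈ H j, {x : E | ⟪q.1, x⟫ < q.2}) ∧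
      (∀ j, ∀ G : Finset (E × ℝ), G ⊆ 𝓗 →
        (⋂ q ∈ H j, {x : E | ⟪q.1, x⟫ < q.2}) ⊆ (⋂ p ∈ G, {x : E | ⟪p.1, x⟫ < p.2}) ∨
        Disjoint (⋂ q ∈ H j, {x : E | ⟪q.1, x⟫ < q.2}) (⋂ p ∈ G, {x : E | ⟪p.1, x⟫ < p.2})) ∧
      (∀ 𝒢' : Finset (Finset (E × ℝ)), 𝒢' ⊆ 𝒢 →
        (⋃ G ∈ 𝒢', ⋂ p ∈ G, {x : E | ⟪p.1, x⟫ < p.2}) =ᵐ[volume]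
          ⋃ (j) (_ : ∃ G ∈ 𝒢', (⋂ q ∈ H j, {x : E | ⟪q.1, x⟫ < q.2}) ⊆ ⋂ p ∈ G, {x : E | ⟪p.1, x⟫ < p.2}),
            ⋂ q ∈ H j, {x : E | ⟪q.1, x⟫ < q.2}) := by
  -- the signed constraint Finset and the cell of a positive part `T`
  set sgn : Finset (E × ℝ) → Finset (E × ℝ) :=
    fun T => 𝓗.image (fun p : E × ℝ => if p ∈ T then p else (-p.1, -p.2)) with hsgn
  set cell : Finset (E × ℝ) → Set E := fun T => ⋂ q ∈ sgn T, {x : E | ⟪q.1, x⟫ < q.2} with hcell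
  -- the nonempty good cells
  set goodAll : Finset (Finset (E × ℝ)) := 𝓗.powerset.filter (fun T => ∃ G ∈ 𝒢, G ⊆ T)
    with hgoodAll
  set good : Finset (Finset (E × ℝ)) := goodAll.filter (fun T => (cell T).Nonempty) with hgood
  have hgood_sub : ∀ T ∈ good, T ⊆ 𝓗 := fun T hT =>
    Finset.mem_powerset.1 (Finset.mem_filter.1 (Finset.mem_filter.1 hT).1).1
  have hgood_G : ∀ T ∈ good, ∃ G ∈ 𝒢, G ⊆ T := fun T hT =>
    (Finset.mem_filter.1 (Finset.mem_filter.1 hT).1).2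
  have hgood_ne : ∀ T ∈ good, (cell T).Nonempty := fun T hT => (Finset.mem_filter.1 hT).2
  -- enumeration
  set k : ℕ := good.card with hk
  set e : {T // T ∈ good} ≃ Fin k := good.equivFin with he
  set Tof : Fin k → Finset (E × ℝ) := fun j => (e.symm j).1 with hTof
  have hTof_mem : ∀ j, Tof j ∈ good := fun j => (e.symm j).2
  have hTof_inj : ∀ j j', j ≠ j' → Tof j ≠ Tof j' := by
    intro j j' hjj' h
    apply hjj'
    have : e.symm j = e.symm j' := Subtype.ext h
    simpa using congrArg e this
  -- separating constraint for two distinct cells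
  have hsep : ∀ j j', j ≠ j' → ∃ p ∈ 𝓗, (p ∈ Tof j ∧ p ∉ Tof j') ∨ (p ∈ Tof j' ∧ p ∉ Tof j) :=
    fun j j' hjj' => exists_mem_not_mem_of_ne (hgood_sub _ (hTof_mem j)) (hgood_sub _ (hTof_mem j'))
      (hTof_inj j j' hjj')
  -- the normals
  set ν : Fin k → Fin k → E := fun j j' =>
    if h : j ≠ j' then (Classical.choose (hsep j j' h)).1 else 0 with hν
  refine ⟨k, fun j => sgn (Tof j), ν, ?_, ?_, ?_, ?_, ?_, ?_, ?_, ?_, ?_⟩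
  · -- bounded
    intro j
    obtain ⟨G, hG, hGT⟩ := hgood_G _ (hTof_mem j)
    exact isBounded_arrCell_of_subset 𝓗 (Tof j) (h𝒢 G hG) hGT (hb G hG)
  · -- unit normals
    intro j q hq
    exact norm_fst_eq_one_of_mem_signed 𝓗 (Tof j) h1 hq
  · -- distinct planes
    intro j q hq q' hq' hqq'
    exact setOf_inner_eq_ne_of_arrCell_nonempty 𝓗 (Tof j) h1 (hgood_ne _ (hTof_mem j)) hq hq' hqq'
  · -- disjoint
    intro j j' hjj'
    obtain ⟨p, hp, h⟩ := hsep j j' hjj'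
    rcases h with ⟨hpT, hpT'⟩ | ⟨hpT', hpT⟩
    · exact disjoint_arrCell 𝓗 (Tof j) (Tof j') hp hpT hpT'
    · exact (disjoint_arrCell 𝓗 (Tof j') (Tof j) hp hpT' hpT).symm
  · -- common plane
    intro j j' hjj'
    have hspec := Classical.choose_spec (hsep j j' hjj')
    set p := Classical.choose (hsep j j' hjj') with hpdef
    have hνp : ν j j' = p.1 := by
      show (if h : j ≠ j' then (Classical.choose (hsep j j' h)).1 else 0) = p.1
      rw [dif_pos hjj']
    refine ⟨by rw [hνp]; exact h1 p hspec.1, p.2, ?_⟩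
    rw [hνp]
    rcases hspec.2 with ⟨hpT, hpT'⟩ | ⟨hpT', hpT⟩
    · exact closure_arrCell_inter_subset_plane 𝓗 (Tof j) (Tof j') hspec.1 hpT hpT'
    · rw [Set.inter_comm]
      exact closure_arrCell_inter_subset_plane 𝓗 (Tof j') (Tof j) hspec.1 hpT' hpT
  · -- inside the polyhedral set
    intro j
    obtain ⟨G, hG, hGT⟩ := hgood_G _ (hTof_mem j)
    exact (arrCell_subset_polytope 𝓗 (Tof j) (h𝒢 G hG) hGT).trans
      (subset_iUnion₂ (s := fun G (_ : G ∈ 𝒢) => ⋂ p ∈ G, {x : E | ⟪p.1, x⟫ < p.2}) G hG)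
  · -- a.e. equality: the good cells exhaust the set, empty cells are irrelevant
    have hn : ∀ p ∈ 𝓗, p.1 ≠ 0 := fun p hp h0 => by
      have := h1 p hp; rw [h0, norm_zero] at this; exact zero_ne_one this
    have hae := iUnion_polytope_ae_eq_iUnion_arrCell 𝓗 hn 𝒢 h𝒢
    refine hae.trans (ae_eq_set.2 ⟨?_, ?_⟩ : _)
    · -- goodAll-union \ enumerated union is EMPTY
      rw [Set.sdiff_eq_empty.2 ?_, measure_empty]
      intro x hx
      rw [mem_iUnion₂] at hx
      obtain ⟨T, hT, hxT⟩ := hx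
      have hTgood : T ∈ good := Finset.mem_filter.2 ⟨hT, ⟨x, hxT⟩⟩
      refine mem_iUnion.2 ⟨e ⟨T, hTgood⟩, ?_⟩
      have : Tof (e ⟨T, hTgood⟩) = T := by
        rw [hTof]; simp
      show x ∈ cell (Tof (e ⟨T, hTgood⟩))
      rw [this]; exact hxT
    · rw [Set.sdiff_eq_empty.2 ?_, measure_empty]
      intro x hx
      rw [mem_iUnion] at hx
      obtain ⟨j, hxj⟩ := hx
      exact mem_iUnion₂.2 ⟨Tof j, (Finset.mem_filter.1 (hTof_mem j)).1, hxj⟩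
  · -- dichotomy against every sub-Finset of constraints
    intro j G hG
    by_cases hGT : G ⊆ Tof j
    · exact Or.inl (arrCell_subset_polytope 𝓗 (Tof j) hG hGT)
    · exact Or.inr (disjoint_arrCell_polytope 𝓗 (Tof j) hG hGT)
  · -- a.e. equality for every sub-family
    intro 𝒢' h𝒢'
    have hn : ∀ p ∈ 𝓗, p.1 ≠ 0 := fun p hp h0 => by
      have := h1 p hp; rw [h0, norm_zero] at this; exact zero_ne_one this
    refine ae_eq_set.2 ⟨?_, ?_⟩
    · refine measure_mono_null ?_ (volume_iUnion_planes_eq_zero 𝓗 hn)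
      intro x hx
      obtain ⟨hx1, hx2⟩ := hx
      by_contra hxN
      apply hx2
      rw [mem_iUnion₂] at hx1
      obtain ⟨G, hG', hxG⟩ := hx1
      set T : Finset (E × ℝ) := 𝓗.filter (fun p => ⟪p.1, x⟫ < p.2) with hT
      have hxT : x ∈ cell T := mem_arrCell_filter 𝓗 hxN
      have hGT : G ⊆ T := by
        intro p hp
        rw [mem_iInter₂] at hxG
        exact Finset.mem_filter.2 ⟨h𝒢 G (h𝒢' hG') hp, hxG p hp⟩
      have hTall : T ∈ goodAll := Finset.mem_filter.2
        ⟨Finset.mem_powerset.2 (Finset.filter_subset _ _), G, h𝒢' hG', hGT⟩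
      have hTgood : T ∈ good := Finset.mem_filter.2 ⟨hTall, ⟨x, hxT⟩⟩
      have hTof_e : Tof (e ⟨T, hTgood⟩) = T := by rw [hTof]; simp
      refine mem_iUnion₂.2 ⟨e ⟨T, hTgood⟩, ⟨G, hG', ?_⟩, ?_⟩
      · show cell (Tof (e ⟨T, hTgood⟩)) ⊆ _
        rw [hTof_e]
        exact arrCell_subset_polytope 𝓗 T (h𝒢 G (h𝒢' hG')) hGT
      · show x ∈ cell (Tof (e ⟨T, hTgood⟩))
        rw [hTof_e]; exact hxT
    · rw [Set.sdiff_eq_empty.2 ?_, measure_empty]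
      intro x hx
      rw [mem_iUnion₂] at hx
      obtain ⟨j, ⟨G, hG', hjG⟩, hxj⟩ := hx
      exact mem_iUnion₂.2 ⟨G, hG', hjG hxj⟩

end Summit.Ventures.Crystal3D.Theorems

end
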